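import Mathlib
import HarnessLib
import HarnessLib.Audit
import Summits.ABC.ABC.Statement
import Literature.Barriers.ABC.BakerMethodBounds
import Literature.NumberTheory.DiophantineGeometry.AbcValuationProduct
import Literature.NumberTheory.DiophantineGeometry.MultiplicativeGroupApproximation

/-!
Route: GiantExponentRegime

CLOSED (retired) 2026-08-15T13:36:01Z by operator:999:1090267 — reason: not-a-thesis: assembly does not conclude the sub-problem Statement — note: D-0027 §2.1 audit (human 2026-08-15: routes that do not decide the summit are removed): the assembly concludes `SubexpABC`, not the sub-problem statement; a NEW conforming route may be opened from the same idea (generated `closes : … → _root_.ABC`).. The file is kept as the record of this route; refuted decls are indexed as negative knowledge (`ledger negatives`).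

MILESTONE ROUTE realising idea card ABC/ABC/giant-exponent-large-prime-regime (no arrow to
Summit.ABC is claimed; shape Cruxes → Target, as for other accepted milestone routes). Target T =
SubexpABC := ∀ ε>0, Literature.Barriers.ABC.BakerShapeBound ε 0, i.e. log c ≪_ε rad(abc)^ε —
strictly between Stewart–Yu 2001 / Pasten 2024 Thm 1.4 (sub-exponential only in the unbalanced and
one-smooth-member regimes) and ABC (ABC ⟹ T trivially, not conversely).
THESIS: it suffices for T to show X = NoGiantExponent ("after Pasten, subexponential abc is ONE
configuration"): for every ε>0 and rad(abc) ≥ R₀(ε), no prime p ≥ rad(abc)^ε divides abc with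
exponent ≥ rad(abc)^ε — a+b is never divisible by p^v with p and v both ≥ rad^ε. X is in turn
EQUIVALENT (given the same named facts) to one p-adic transcendence statement of exact Yu/Pasten
shape, SuperconvergentLFL: in Pasten's grouped form of Yu's estimate the factor p/log p may be
replaced by p^δ whenever the depth ord_p(1−x) is at least Q^ε, Q = rad(num x · den x · num(1−x)) the
radical of the unit equation x + (1−x) = 1. The two cruxes are the configuration face
(constructions; modular/level-lowering methods) and the transcendence face (p-adic LFL) of the same
residual; the four reductions X → T (Assembly = the regime lemma: Pasten's product theorem + grouped
Yu + Stewart–Yu), T → X, SuperconvergentLFL → X, T → SuperconvergentLFL are provable now and filed,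
as is the calibration lemma showing that the card's LOCAL version (depth ≥ p^ε) is uniform
super-Wieferich sparsity already at one logarithm.
Lean (X; elaborates, Sketch.lean rc 0): ∀ ε : ℝ, 0 < ε → ∃ R₀ : ℝ, ∀ a b c : ℕ,
Literature.NumberTheory.DiophantineGeometry.IsABCTriple a b c → R₀ ≤ (rad a b c : ℝ) → ∀ p : ℕ,
p.Prime → (rad a b c : ℝ) ^ ε ≤ p → ((a*b*c).factorization p : ℝ) < (rad a b c : ℝ) ^ ε.  Assembly :
pasten2024_thm_2_5 → Dioph.evertseGyory_thm_4_2_1_rat → stewart_yu → NoGiantExponent → SubexpABC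
(all constants under Literature.NumberTheory.DiophantineGeometry; BakerShapeBound under
Literature.Barriers.ABC).

Rationale: WHY THIS LINE. Regime decomposition driven by a PROVED-in-print product theorem: Pasten's ∏_{p|abc}
ν_p(abc) ≤ κ_δ rad^{8/3+δ} [PastenShimura2024 Thm 16.8 = Pasten2024 Thm 2.5; in tree as the named
fact pasten2024_thm_2_5] bounds the number of exponents ≥ R^β by 3/β, and Pasten's grouped form of
Yu's p-adic estimate [Pasten2024 Thm 2.1(ii); in tree PROVED from the named fact
Dioph.evertseGyory_thm_4_2_1_rat] pushes any exponent ≥ R^{ε} to a prime ≥ R^{ε−β−o(1)}. Hence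
(Assembly, provable now) subexponential abc ⟺ GEB: the entire gap between Stewart–Yu [StewartYu2001]
/ Pasten 1.4 and log c ≪ rad^ε is the single configuration "p^v ∥ a+b with p, v ≥ rad^ε". Imported
area: p-adic transcendence (Yu 1998–2013) + Shimura-curve product theorem; the route's own theorems
are the equivalences, the rest is the bet.
RANKED CRUXES. r2 SuperconvergentLFL — Yu/Pasten shape with p/log p ↦ p^δ under depth ord_p(1−x) ≥
Q^ε (Q = radical of the unit equation). Chosen over the card's K1 (depth ≥ p^ε) because that local
form, at ONE logarithm (ξ=2, b=p−1), asserts ord_p(2^{p−1}−1) < p^ε for all large p — uniform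
super-Wieferich sparsity, not implied even by ABC (abc gives o(p/log p) [Silverman1988]) and exactly
where Yu's factor p is the trivial Wieferich-order bound ([Stewart2013] Thm 2:
ord_p(a^{p−1}−b^{p−1}) < p·exp(−log p/(52 loglog p))·log a; Yamada p/(log p)²); filed as
WieferichCalibration (support, provable). With Q in the hypothesis the crux is implied by the target
(LFLOfSubexp) and implies GEB (GEBOfSuperconvergentLFL, no LFL fact needed) — the exact
transcendence residual. r3 NoGiantExponent (GEB) — the configuration face; target of constructions
and of the modular attack.
KILL CRITERIA. A family of abc triples with p ≥ rad^ε, v_p(abc) ≥ rad^ε (refutes GEB, the crux, T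
and subexp-abc at once); or a proof that SuperconvergentLFL fails for some S-unit family with depth
≥ Q^ε (same effect via LFLOfSubexp: it would refute T). A proof that the crux needs BW's (ii) (sum
of heights) would not kill but would merge this line into the generic Baker barrier.
DELIBERATELY NOT DECOMPOSED. (a) The modular attack (card K2): c_p = v_p(Δ_min) = order of the p-OLD
congruence module (Ribet–Takahashi; Böckle–Khare–Manning), each p-old partner's depth Hasse-bounded
by |a_p(g)| ≤ 2√p, crux = count of p-old partners ≤ R^{o(1)} at p ≥ R^ε incl. the 2-adic depth for v
a power of 2 — untypable today (no newform/congruence-module vocabulary); it is a SIBLING route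
sharing NoGiantExponent and SubexpABC, to be opened when that vocabulary lands. (b) No split of the
transcendence crux before a refuter/grounder pass; Yu2013's |⟨ξ̄_i⟩ mod p| handle and the 'all
generators Q^{o(1)}-smooth & p ≥ Q^η' known sub-case (Pasten 1.4(2) mechanism) are recorded in its
docstring. (c) T → Summit.ABC: not claimed.
SIBLING ROUTES (opened today, read): route-ABC-RibetTakahashiSplit files the SAME milestone decl
SubexpABC (stmt-ABC-1569, ∀ε BakerShapeBound ε 0 — this route attaches to it as its target) and
reaches it from the modular side via AbcValuationProduct (∏ν_p ≤ K_ε rad^ε, which trivially implies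
NoGiantExponent too); route-ABC-LogCardinality's crux PadicPowerSaving asks for a UNIFORM saving
p^{1−δ} (some δ) in the same Pasten clause and its WieferichShadow records the same Wieferich
obstruction found here independently — our crux is the complementary corner: FULL saving p^δ (every
δ) but only at depth ≥ Q^ε, which is target-equivalent instead of ABC-independent. No item of either
route is restated here (signatures checked).
NOVELTY and BARRIERS (D-0021): see the Novelty and Barriers sections of this header (passed to the
gate as separate fields); technique_class: p-adic-logarithmic-forms regime-decomposition
pasten-product-theorem.

Novelty: Nearest prior art actually read: Pasten arXiv:2312.03566 = Pasten2024 (Thm 1.4(1),(2), Thm 2.1,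
grouping trick; triage-10 read pp.3–4, 8–9: the balanced/large-prime residue is left implicit, no
equivalence stated); Surroca2007 (read arXiv math/0501285 p.2: abc ⟺ 'Siegel uniforme' ⟺ S-uniform
height bound for u+v=1 — the classical abc/S-unit dictionary at FULL strength); Philippon1999 §3 and
BakerWustholz2007 §3.7 (conjectural several-places / Ξ LFL ⟹ polynomial abc); Stewart2013 + Yu2013
(read arXiv 1008.1274 pp.4–5, 8–9: state of Yu's p-dependence). Delta: (1) the residual-regime
equivalence SubexpABC ⟺ GEB as a Lean target over in-tree named facts; (2) its LFL face: ONE place,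
product of heights kept, p^δ loss, needed only at depth ≥ Q^ε — proved EQUIVALENT to the
subexponential milestone (not merely sufficient for abc^η as in Philippon/BW); (3) the calibration
that the local version is super-Wieferich sparsity. Searches 2026-08-15: lit frontier ABC --since
2021 (30 rows; none on exponents at large primes; arXiv:2606.08416 opened, unrelated), lit search
--hybrid 'valuation large prime abc triple exponent subexponential' (EvertseGyory2015 only), lit
galaxy search 'subexponential abc' --star all (0 hits), 'linear forms in p-adic logarithms' --star
all (pdf: 1604.04720 Pink–Ziegler, Scoones 2023 thesis, Bugeaud–Luca 2006 — not this), crossref for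
Yu2013/Yu2007/Stewart2013/Surroca2007. Claimed grade: new-combination.  [refs: 2312.03566, math/0501285, 1008.1274, 2606.08416, Pasten2024, Surroca2007, Philippon1999, BakerWustholz2007, Stewart2013, Yu2013, EvertseGyory2015, Yu2007]

Barriers (technique_class: p-adic-logarithmic-forms regime-decomposition product-thm): - Literature.Barriers.ABC.BakerMethodBounds: ENGAGED and respected — every statement here has Baker
shape; T = BakerShapeBound ε 0 ∀ε is exactly the corner its evasions_known (c) leaves open after
Pasten 1.4, still short of θ=0; the crux names the one constant to move (p/log p ↦ p^δ) and only
under depth ≥ Q^ε; the barrier's diagnosis (Baker–Wüstholz (i) all places at once; Philippon Σ log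
Nv vs Σ Nv) is WHY the hypothesis must be global (Q): the local form is shown Wieferich-hard; BW
(ii) (sum of heights, needed for polynomial abc) is not touched, so nothing here claims θ = 0.
- Literature.Barriers.ABC.EpsilonCannotBeDropped,
Literature.Barriers.ABC.SzpiroEpsilonCannotBeDropped: not engaged (targets exponentially weaker than
ε-free forms).
- Literature.Barriers.ABC.IUTDisputedClaim: nothing imported.
- Negatives index (ledger negatives --problem ABC, 2026-08-15): empty; no item restates a refuted
statement.

History (route lifecycle, newest last):
- 2026-08-15T13:36:01Z · CLOSED retired — not-a-thesis: assembly does not conclude the sub-problem Statement (operator:999:1090267)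

sub-problem: ABC · status: closed(retired) · opened planner-plancard-ABC-ABC-giant-exponent-large-5c739f9d-0 2026-08-15T11:02:42Z · rev 2 · ledger route-ABC-GiantExponentRegime
GENERATED by the gate from the ledger (D-0016/17). Provers cite these decls: `theorem foo : Summit.ABC.ABC.Theses.GiantExponentRegime.<Decl> := …` in Summits/ABC/ABC/Theorems/<Name>.lean.
-/

namespace Summit.ABC.ABC.Theses.GiantExponentRegime

open scoped BigOperators Topology Manifold Classical MeasureTheory ProbabilityTheory Matrix InnerProductSpace ComplexConjugate ContinuousMap
open Filter Set Function TopologicalSpace MeasureTheory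

attribute [summit_statement] _root_.ABC

open Literature.Abc

/-- item stmt-ABC-1569 · target · rank 0 · open · by planner
why it might fail: ⇐ ABC, open: subexponential Szpiro log Δ ≪ N^ε is 'currently an open problem' (PastenShimura2024, arXiv:1705.09251 p.8); known only for ε > 1/3 (Stewart–Yu 2001 Thm 1) and in Pasten's two regimes (Pasten2024 Thm 1.4). As TARGET it closes only via Assembly + NoGiantExponent, through the named facts.
sources: StewartYu2001, Pasten2024, PastenShimura2024, arXiv:1705.09251, Literature.Barriers.ABC.BakerMethodBounds, Literature.NumberTheory.DiophantineGeometry.stewart_yu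
[support] MILESTONE (shared, file once): sub-exponential abc for ALL triples, forall eps > 0,
BakerShapeBound eps 0 (log c <= kappa_eps rad^eps). <= AbcValuationProduct (glue
SubexpOfValuationProduct), hence <= r2 AND r4. Pasten p.8: Conj. 1.14 'implies a sub-exponential
version of Szpiro's conjecture of the form log Delta_E << N^eps, which is currently an open
problem'. Strictly between Literature.NumberTheory.DiophantineGeometry.stewart_yu and ABC
(WeakABCConjecture -> BakerShapeBound 0 1 in the barrier file). -/
@[route_item "route-ABC-GiantExponentRegime"]
def SubexpABC : Prop :=
  ∀ ε : ℝ, 0 < ε → Literature.Barriers.ABC.BakerShapeBound ε 0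

/-- item stmt-ABC-2256 · crux · rank 2 · closed · moot by None · by planner
why it might fail: ⇔ target (LFLOfSubexp, GEBOfSuperconvergentLFL): false iff subexp-abc fails. As transcendence, far out: no p-adic LFL beats the factor p^{1−o(1)} (Yu2007 p/log p; Yu2013 p↦|⟨ξ̄ᵢ⟩ mod p|; Stewart2013 Thm 2 p·exp(−log p/52loglog p)) or uses a GLOBAL hypothesis (Q = rad of 1−x); locally Wieferich-hard.
sources: Pasten2024, EvertseGyory2015, Yu2007, Yu2013, Stewart2013, Philippon1999
[crux] Super-convergent smooth-radical p-adic LFL: Pasten's grouped form of Yu's estimate (in tree: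
Dioph.PastenApproximationBound, PROVED from the named fact Dioph.evertseGyory_thm_4_2_1_rat; =
Pasten2024 Thm 2.1(ii): ord_p(1−x)·log p < K^m·(p/log p)·log max{e, p·h(x)}·∏ h(ξ_i), x =
±∏ξ_i^{b_i} ≠ 1) with p/log p REPLACED BY p^δ, demanded ONLY when the depth v = ord_p(1−x) is ≥ Q^ε,
Q = rad(num x·den x·num(1−x)) = radical of the unit equation x + (1−x) = 1 (all primes involved are
< v^{1/ε}). Why this shape: (i) it is what the grouping argument consumes (GEBOfSuperconvergentLFL:
crux ⟹ GEB from Pasten's product theorem + Stewart–Yu alone); (ii) it is implied by the target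
(LFLOfSubexp): the EXACT transcendence residual of subexponential abc, not harder than it; (iii)
depth measured against p instead (the card's K1) is Wieferich-hard already for one logarithm
(WieferichCalibration). Open core: p ∈ [Q^η, Q] with one high-height generator (the lump ξ₀ of
small-exponent primes); known: p ≤ (log Q)^{1+o(1)} (Yu); small-prime generators with p ≥ Q^η
(Pasten 1.4(2)). Handle: Yu2013 (p ↦ |⟨ξ̄_i⟩ mod p|). [Pasten2024 Thm 2.1] [Yu2007] [Yu2013]
[Stewart2013] [Philippon1999 §3] -/
@[route_item "route-ABC-GiantExponentRegime"]
def SuperconvergentLFL : Prop :=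
  ∀ ε : ℝ, 0 < ε → ∀ δ : ℝ, 0 < δ → ∃ K : ℝ, ∀ (ι : Type) [Fintype ι], 0 < Fintype.card ι → ∀ ξ : ι → ℚ, (∀ i, ξ i ≠ 0 ∧ ξ i ≠ 1 ∧ ξ i ≠ -1) → ∀ ζ : ℚ, (ζ = 1 ∨ ζ = -1) → ∀ b : ι → ℤ, ∀ x : ℚ, x = ζ * ∏ i, ξ i ^ b i → x ≠ 1 → ∀ p : ℕ, p.Prime → ((UniqueFactorizationMonoid.radical (x.num.natAbs * x.den * (1 - x).num.natAbs) : ℕ) : ℝ) ^ ε ≤ (padicValRat p (1 - x) : ℝ) → (padicValRat p (1 - x) : ℝ) * Real.log p ≤ K ^ Fintype.card ι * (p : ℝ) ^ δ * Real.log (max (Real.exp 1) (p * Height.logHeight₁ x)) * ∏ i, Height.logHeight₁ (ξ i)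

/-- item stmt-ABC-2257 · crux · rank 3 · closed · moot by None · by planner
why it might fail: ⇔ target (Assembly, GEBOfSubexp): false iff subexp-abc fails; open only for ε≤1/3 (ε>1/3 by Stewart–Yu). Killer: infinitely many p^v∥abc, p,v ≥ rad^ε, e.g. 1+(p^v−1)=p^v with p·rad(p^v−1) ≤ min(p,v)^{1/ε}; none known. Small instances exist (2+3^10·109=23^5: 23,5 > rad^{1/6}): the content is R₀(ε).
sources: Pasten2024, PastenShimura2024, StewartYu2001, VanFrankenhuysen2000, arXiv:2312.03566, arXiv:1705.09251
[crux] Giant-Exponent Bound (GEB), the configuration face of the milestone: for every ε>0 and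
rad(abc) ≥ R₀(ε), no prime p ≥ rad(abc)^ε divides abc to a power ≥ rad(abc)^ε ('a+b is never
divisible by p^v with p and v both ≥ rad^ε'; exponent 0 if p ∤ abc). By the Assembly GEB ⟹ SubexpABC
and by GEBOfSubexp conversely: after Pasten 2024 (Thm 1.4(1) unbalanced, (2) one smooth member) the
whole gap between Stewart–Yu and subexponential abc is this ONE local configuration. Attacks:
SuperconvergentLFL (transcendence face), or — SIBLING ROUTE to open when newform congruence-module
vocabulary exists — Hasse-bounded p-OLD level-lowering congruences of the Frey form at p ≥ R^ε: c_p
= v_p(Δ_min) is the order of the p-old congruence module (Ribet–Takahashi; Böckle–Khare–Manning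
arXiv:2108.09729); a p-old partner g has depth ≤ 2d_g·log(3p)/log Nλ since λ^k ∣ a_p(g)² − (p+1)² ≠
0 (|a_p(g)| ≤ 2√p); so GEB at p ⟸ #{p-old partners of f_E, with multiplicity} ≤ R^{o(1)}, the 2-adic
depth (v a power of 2, ρ̄_{E,2} reducible) being the trap. Hub statement shared with that sibling
and with refuters' constructions. [Pasten2024 Thm 1.4, 2.5] [PastenShimura2024 Thm 16.8]
[StewartYu2001] -/
@[route_item "route-ABC-GiantExponentRegime"]
def NoGiantExponent : Prop :=
  ∀ ε : ℝ, 0 < ε → ∃ R₀ : ℝ, ∀ a b c : ℕ, Literature.NumberTheory.DiophantineGeometry.IsABCTriple a b c → R₀ ≤ ((Literature.NumberTheory.DiophantineGeometry.rad a b c : ℕ) : ℝ) → ∀ p : ℕ, p.Prime → ((Literature.NumberTheory.DiophantineGeometry.rad a b c : ℕ) : ℝ) ^ ε ≤ (p : ℝ) → (((a * b * c).factorization p : ℕ) : ℝ) < ((Literature.NumberTheory.DiophantineGeometry.rad a b c : ℕ) : ℝ) ^ ε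

/-- item stmt-ABC-2258 · support · rank 9 · closed · moot by None · by planner
sources: Pasten2024, StewartYu2001
[support] PROVABLE NOW (no p-adic LFL fact needed). Fix ε; R = rad(abc) ≥ R₀, p ≥ R^ε prime, v :=
v_p(abc) ≥ R^ε; derive a contradiction. p divides exactly one member; x := ratio of the other two,
signed so that num(1−x) = ± that member (p∣c: x = −a/b, 1−x = c/b; p∣a: x = c/b, 1−x = −a/b; p∣b: x
= c/a): ord_p(1−x) = v, h(x) ≤ log c, Q(x) = rad(abc) = R, so the hypothesis v ≥ Q^ε holds. Group
(Pasten's trick) with β = ε/3: generators = the lump ξ₀ = ∏_{q: v_q < R^β} q^{±v_q} (h(ξ₀) < R^β log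
R; drop if = 1) and the primes q of the two members with v_q ≥ R^β (h = log q ≤ log R), at most 3/β
of them by pasten2024_thm_2_5 at exponent 8/3+1/10 ((R^β)^{#} ≤ ∏ν_q ≤ κR^{2.77}); 1 ≤ m ≤ 9/ε + 1
(m = 0 forces a = b = 1). Crux at (ε, δ = ε/3): v log p ≤ K^m p^{ε/3}·log max{e, p log
c}·R^{ε/3}(log R)^m ≤ K^m R^{2ε/3}(2 log R)(log R)^m by p ≤ R and log c ≤ C R^{1/3}(log R)^3
(stewart_yu) — contradicting v log p ≥ R^ε log 2 for R ≥ R₀(ε). Tools: Rat.logHeight₁_eq_log_max,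
padicValRat of quotients, Nat.factorization, Real.rpow. -/
@[route_item "route-ABC-GiantExponentRegime"]
def GEBOfSuperconvergentLFL : Prop :=
  Literature.NumberTheory.DiophantineGeometry.pasten2024_thm_2_5 → Literature.NumberTheory.DiophantineGeometry.stewart_yu → SuperconvergentLFL → NoGiantExponent

/-- item stmt-ABC-2259 · support · rank 9 · closed · moot by None · by planner
sources: StewartYu2001
[support] PROVABLE NOW, elementary: SubexpABC → NoGiantExponent. SubexpABC at ε/2 gives log c ≤ κ
R^{ε/2}; for p ≥ R^ε (so log p ≥ ε log R), v_p(abc)·log p ≤ log(abc) ≤ 3 log c, hence v_p ≤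
3κR^{ε/2}/(ε log R) < R^ε once R ≥ R₀(ε); v_p = 0 < R^ε if p ∤ abc. The easy half of SubexpABC ⟺
NoGiantExponent (the Assembly is the other half). -/
@[route_item "route-ABC-GiantExponentRegime"]
def GEBOfSubexp : Prop :=
  SubexpABC → NoGiantExponent

/-- item stmt-ABC-2260 · support · rank 9 · closed · moot by None · by planner
sources: Surroca2007, StewartYu2001
[support] PROVABLE NOW, elementary (calibration from above: the crux is NOT stronger than the
milestone): SubexpABC → SuperconvergentLFL. Given x = ±∏ξ_i^{b_i} ≠ 1 write x = ±u/w in lowest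
terms, t := |num(1−x)| = |w ∓ u| ≥ 1; then (u,t,w), (w,t,u) or (u,w,t) is an abc triple (coprime,
positive) with radical exactly Q(x) = rad(u·w·t) and largest member ≥ t ≥ p^v, v = ord_p(1−x). If v
≥ Q^ε then Q^ε·log 2 ≤ v log p ≤ log c ≤ κ Q^{ε/2} (SubexpABC at ε/2), so Q ≤ (κ/log 2)^{2/ε} and v
log p ≤ κ·(κ/log 2) =: V (depends on ε only). The right side of the crux is ≥ (K log 2)^m ≥ K log 2
since h(ξ_i) ≥ log 2 for ξ_i ∈ ℚ∖{0,±1}, p^δ ≥ 1, log max{e,·} ≥ 1, m ≥ 1; take K := max(V,1)/log 2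
+ 1. No finiteness theorem needed. Cf. Surroca2007 (abc ⟺ uniform height bound for u+v=1) for the
full-strength dictionary. -/
@[route_item "route-ABC-GiantExponentRegime"]
def LFLOfSubexp : Prop :=
  SubexpABC → SuperconvergentLFL

/-- item stmt-ABC-2261 · support · rank 9 · closed · moot by None · by planner
sources: Stewart2013, Silverman1988, Yu2013
[support] PROVABLE NOW; the calibration behind the crux's GLOBAL hypothesis. Antecedent = the idea
card's original K1 at ONE logarithm: Yu's bound with p/log p ↦ p^δ whenever ord_p(1−ξ₁^n) ≥ p^ε
(depth measured against p, not Q). Proof: fix ε, apply it with (ε, δ := ε/2) to get K; for a prime p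
≥ 3 with w := ord_p(2^{p−1}−1) = padicValRat p (1 − 2^{p−1}) ≥ p^ε (ξ₁ = 2, n = p−1) it gives w log
p ≤ K p^{ε/2}·log(p(p−1) log 2)·log 2 ≤ 1.39K·p^{ε/2} log p (h(2) = log 2, h(2^{p−1}) = (p−1) log
2), so p^{ε/2} ≤ 1.39K: for p > p₀(ε), ord_p(2^{p−1}−1) < p^ε (K ≤ 0: hypothesis never met, same
conclusion). This is uniform sparsity of (super-)Wieferich primes, which even ABC does not give (abc
on (1, 2^{p−1}−1, 2^{p−1}) yields only ord_p(2^{p−1}−1) = o(p/log p); Silverman1988 is the abc ⟹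
non-Wieferich direction) and where only the trivial w < p·log 2/log p is known up to p^{o(1)}:
Stewart2013 Thm 2, ord_p(a^{p−1}−b^{p−1}) < p·exp(−log p/(52 loglog p))·log a; Yamada C(p/(log p)²)
log a (ibid. (10)). Moral: at one logarithm Yu's factor p IS the Wieferich order; hence the crux
measures depth against Q. -/
@[route_item "route-ABC-GiantExponentRegime"]
def WieferichCalibration : Prop :=
  (∀ ε : ℝ, 0 < ε → ∀ δ : ℝ, 0 < δ → ∃ K : ℝ, ∀ ξ₁ : ℚ, ξ₁ ≠ 0 → ξ₁ ≠ 1 → ξ₁ ≠ -1 → ∀ n : ℤ, ξ₁ ^ n ≠ 1 → ∀ p : ℕ, p.Prime → (p : ℝ) ^ ε ≤ (padicValRat p (1 - ξ₁ ^ n) : ℝ) → (padicValRat p (1 - ξ₁ ^ n) : ℝ) * Real.log p ≤ K * (p : ℝ) ^ δ * Real.log (max (Real.exp 1) (p * Height.logHeight₁ (ξ₁ ^ n))) * Height.logHeight₁ ξ₁) → ∀ ε : ℝ, 0 < ε → ∃ p₀ : ℕ, ∀ p : ℕ, p.Prime → p₀ ≤ p → (padicValNat p (2 ^ (p - 1)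 - 1) : ℝ) < (p : ℝ) ^ ε

/-- item stmt-ABC-3645 · support · rank 9 · closed · moot by None · by planner
sources: Pasten2024, PastenShimura2024, arXiv:2312.03566, arXiv:1705.09251, Literature.NumberTheory.DiophantineGeometry.pasten2024_thm_2_5, StewartYu2001
[support · needs-fact] FEW LARGE EXPONENTS — the one consequence of Pasten's product theorem this
route consumes (input of the regime lemma = Assembly X → T and of GEBOfSuperconvergentLFL, in place
of the named fact), typed over the Statement's cone: for every β>0 there are B, R₀ such that an abc
triple with R = rad(abc) ≥ R₀ has at most B primes q with v_q(abc) ≥ R^β (every finset of such q has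
card ≤ B; such q are prime factors, v_q ≥ R^β ≥ 1). Do NOT attack it from scratch (XL, Shimura
curves): it is a corollary of the named fact
Literature.NumberTheory.DiophantineGeometry.pasten2024_thm_2_5 (∏_{q∣abc} ν_q ≤ κ_δ R^{8/3+δ}
[Pasten2024 Thm 2.5 = PastenShimura2024 Thm 16.8]): with δ = 1/10, (R^β)^{|s|} ≤ ∏_{q∈s} ν_q ≤
∏_{q∣abc} ν_q ≤ κR^{2.77}, so |s| ≤ (2.77 + log κ⁺/log 2)/β for R ≥ 2. LAND THAT BRIDGE NOW in
Summits/ABC/ABC/Theorems (imports allowed there): `theorem fewLargeExponents_of_pasten (h :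
…pasten2024_thm_2_5) : FewLargeExponents` with --supports FewLargeExponents; the item closes when
pasten2024_thm_2_5_holds lands. needs-fact:
Literature.NumberTheory.DiophantineGeometry.pasten2024_thm_2_5. (Unconditional only for β > 1/3 via
stewart_yu; the regime lemma needs β < ε.) -/
@[route_item "route-ABC-GiantExponentRegime"]
def FewLargeExponents : Prop :=
  ∀ β : ℝ, 0 < β → ∃ B : ℕ, ∃ R₀ : ℝ, ∀ a b c : ℕ, Literature.NumberTheory.DiophantineGeometry.IsABCTriple a b c → R₀ ≤ ((Literature.NumberTheory.DiophantineGeometry.rad a b c : ℕ) : ℝ) → ∀ s : Finset ℕ, (∀ q ∈ s, ((Literature.NumberTheory.DiophantineGeometry.rad a b c : ℕ) : ℝ) ^ β ≤ (((a * b * c).factorization q : ℕ) : ℝ)) → s.card ≤ B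

/-- item stmt-ABC-3646 · support · rank 9 · closed · moot by None · by planner
sources: Pasten2024, EvertseGyory2015, Yu2007, Literature.NumberTheory.DiophantineGeometry.Dioph.evertseGyory_thm_4_2_1_rat, Literature.NumberTheory.DiophantineGeometry.Dioph.pasten2024_thm_2_1
[support · needs-fact] YU–PASTEN p-ADIC BOUND with ∃ absolute K (input of the regime lemma =
Assembly X → T in place of the named fact; the cruxes do not use it): for non-torsion ξ₁…ξ_m ∈ ℚ* (m
≥ 1) and x = ±∏ξ_i^{b_i} ≠ 1, every prime p has ord_p(1−x)·log p < K^m·(p/log p)·log max{e,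
p·h(x)}·∏h(ξ_i) — verbatim clause (ii) of
Literature.NumberTheory.DiophantineGeometry.Dioph.PastenApproximationBound K [Pasten2024 Thm 2.1, d
= 1], PROVED in tree (Dioph.pasten2024_thm_2_1, K = Dioph.pastenK = 480·(16e)^8) from the named fact
Literature.NumberTheory.DiophantineGeometry.Dioph.evertseGyory_thm_4_2_1_rat (Evertse–Győry Thm
4.2.1 over ℚ = Yu's p-adic LFL). ∃K form: no import beyond the Statement's cone. Not to be attacked
from scratch (XL). LAND THE ONE-LINE BRIDGE NOW in Summits/ABC/ABC/Theorems: `theorem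
padicUnitBound_of_EG (h : …evertseGyory_thm_4_2_1_rat) : PadicUnitBound := ⟨Dioph.pastenK, fun ι _
hι ξ hξ ζ hζ b hx p hp => ((Dioph.pasten2024_thm_2_1 h) ι hι ξ hξ ζ hζ b hx).2 p hp⟩` (--supports
PadicUnitBound); the item closes when evertseGyory_thm_4_2_1_rat_holds lands. needs-fact:
Literature.NumberTheory.DiophantineGeometry.Dioph.evertseGyory_thm_4_2_1_rat. -/
@[route_item "route-ABC-GiantExponentRegime"]
def PadicUnitBound : Prop :=
  ∃ K : ℝ, ∀ (ι : Type) [Fintype ι], 0 < Fintype.card ι → ∀ ξ : ι → ℚ, (∀ i, ξ i ≠ 0 ∧ ξ i ≠ 1 ∧ ξ i ≠ -1) → ∀ ζ : ℚ, (ζ = 1 ∨ ζ = -1) → ∀ b : ι → ℤ, ζ * ∏ i, ξ i ^ b i ≠ 1 → ∀ p : ℕ, p.Prime → (padicValRat p (1 - ζ * ∏ i, ξ i ^ b i) : ℝ) * Real.log p < K ^ Fintype.card ι * (p / Real.log p) * Real.log (max (Real.exp 1) (p * Height.logHeight₁ (ζ * ∏ i, ξ i ^ b i))) * ∏ i, Height.logHeight₁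 (ξ i)

/-- item stmt-ABC-2262 · assembly · rank 1 · closed · moot by None · by planner
sources: Pasten2024, PastenShimura2024, EvertseGyory2015, StewartYu2001
[assembly] PROVABLE NOW — the REGIME LEMMA (new; Pasten 2024 leaves the balanced/large-prime residue
implicit). Fix ε; R₀ from NoGiantExponent at ε/2. Let R = rad(abc) ≥ R₁ and suppose log c ≥ R^ε.
With β = ε/4, G := {q ∣ abc : v_q ≥ R^β} has |G| ≤ 3/β = 12/ε (pasten2024_thm_2_5 at exponent
8/3+1/10: (R^β)^{|G|} ≤ ∏ν_q ≤ κR^{2.77}) and Σ_{q∉G} v_q log q < R^β log R, so some p ∈ G has v_p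
log p ≥ εR^ε/24, v_p ≥ R^{ε/2}. Build x from the two members coprime to p as in
GEBOfSuperconvergentLFL (ord_p(1−x) = v_p; h(x) ≤ log c ≤ C R^{1/3}(log R)^3 by stewart_yu, so log
max{e, p h(x)} ≤ 2 log R; generators: lump ξ₀ with h < R^β log R and the ≤ 12/ε primes of G, heights
≤ log R; 1 ≤ m ≤ 12/ε+1) and apply Dioph.pasten2024_thm_2_1 (PROVED from evertseGyory_thm_4_2_1_rat,
K = pastenK) at p: εR^ε/24 ≤ v_p log p < K^m (p/log p)(2 log R) R^β (log R)^m, so p ≥ R^{3ε/4−o(1)}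
≥ R^{ε/2} for R ≥ R₁(ε); NoGiantExponent(ε/2) gives v_p < R^{ε/2}: contradiction. So log c < R^ε for
R ≥ R₁; for R < R₁ stewart_yu bounds log c by C R₁^{1/3}(log R₁)^3; κ := max (R^ε ≥ 1). Land 'log c
≥ R^ε ⟹ ∃ p ≥ R^{3ε/4−o(1)} with v_p ≥ R^{ε−o(1)}' first with --supports Assembly. -/
@[route_item "route-ABC-GiantExponentRegime"]
def Assembly : Prop :=
  Literature.NumberTheory.DiophantineGeometry.pasten2024_thm_2_5 → Literature.NumberTheory.DiophantineGeometry.Dioph.evertseGyory_thm_4_2_1_rat → Literature.NumberTheory.DiophantineGeometry.stewart_yu → NoGiantExponent → SubexpABC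

end Summit.ABC.ABC.Theses.GiantExponentRegime
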